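import Summits.AtomisticToContinuum.Crystallization.Theses.SymmetryRankLadder

/-!
# Birth skeleton — crux `SymmetryRankLadder.TriangularLayering`

Item `stmt-AtomisticToContinuum-5832` (crux, rank 3, route `SymmetryRankLadder`, sub-problem
`Crystallization`; piece X₂ of the BC2-redirect decomposition of the deciding crux
`HcpPeriodicMinimiser`, stmt-AtomisticToContinuum-3061, assembly
`Cruxes/HcpPeriodicMinimiser/SplitAssembly.lean`).

The crux (L2): every periodic `Q` with hard core `1/2` and two linearly independent periods of
length `≤ 6/5` is matched, at no higher Lennard-Jones energy per particle, by a periodic MONOLAYER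
TRIANGULAR STACK: for some `a ∈ [47/50, 1]` the period lattice contains `u_a = (a,0,0)`,
`v_a = (a/2, a√3/2, 0)`, points at equal height differ by a vector of `ℤu_a + ℤv_a`, distinct
occupied heights differ by `≥ 7/10`, and above every point there is a point higher by `t ∈ [7/10, 1]`.

First cut — LAYER STRUCTURE first, LATTICE SHAPE second (the route's foreseen glued split
`SingleOrbitLayers → LatticeShapeA2`, typed). The intermediate class 𝓛 of LATTICE-LAYER STACKS:
hard core `1/2`; two linearly independent HORIZONTAL periods `u, v` (`u₃ = v₃ = 0`) of length
`≤ 6/5`; points at equal height differ by a vector of `ℤu + ℤv` (every occupied horizontal plane is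
ONE translate of the 2-D lattice `ℤu + ℤv`, whose shape is free); occupied heights `≥ 7/10` apart;
next layer within `[7/10, 1]`.

* `stub_latticeLayering` — every hard-core periodic `Q` with two short periods is matched, at no
  higher energy per particle, by a member of 𝓛. Content: (i) rotate so that the plane of the two
  short periods is horizontal (`energyPerParticle_isometryImage`, CrystallizationSymmetries.lean) —
  then every occupied plane of `Q` is a finite union of translates of `Λ₂ = Q.lattice ∩ (z = 0)`,
  at most 2 orbits per cell of `ℤu+ℤv` at hard core 1/2 and covolume `≤ (6/5)²·(√3/2)⁻¹`;
  (ii) FLATTEN and THIN: buckled or multi-orbit layers (honeycomb/ω/AlB₂-type) and layer pairs closer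
  than `7/10` are matched by single-orbit flat layers — the certified exclusion of 2-orbit layers, the
  2-D crystallization content of the crux at bounded period (Theil2006's class excludes (12,6):
  `Literature.Barriers.AtomisticToContinuum.not_isAdmissible_lennardJones`; here the period bound
  makes it a finite-dimensional certified comparison); (iii) gaps `> 1` are compressed to `1` at no
  cost (all cross pairs beyond the potential's zero `2^(-1/6)`, `lennardJones` increasing on
  `[1, ∞)`). Size XL (open: (ii)); strictly weaker than the crux in form (lattice shape free).
* `stub_triangularShape` — every member of 𝓛 is matched, at no higher energy per particle, by a
  monolayer TRIANGULAR stack with `a ∈ [47/50, 1]` (the crux's output class). Content: with one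
  orbit per layer and all layers translates of the same 2-D lattice `Λ`, the energy per particle is
  `½ Σ'_Λ V + Σ_(m ≠ 0) Φ_Λ(t_m, offset_m)`; the in-layer term is minimised over shapes at fixed
  covolume by the triangular lattice for the completely monotone pieces (Montgomery1988: `A₂`
  minimises every lattice theta function; Betermin2023 arXiv:2104.09795 Thm 1.1: LJ-type lattice
  optimality, computer-assisted) and the inter-layer registry terms are LJ-signed perturbations of
  relative size `≤ 1e−3` on the admissible window; the scale `a` is then confined to `[47/50, 1]` by a
  certified one-variable comparison. Size L; not the crux (its hypothesis class 𝓛 is the small one).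

Assembly `TriangularLayering_of` (real proof, no `sorry`): `Q ↦ Q₁ ∈ 𝓛` (stub 1), `Q₁ ↦ Q₂`
triangular (stub 2), chain the energies; concludes `SymmetryRankLadder.TriangularLayering` BY NAME.
`TriangularLayering_skeleton` instantiates it (sorries: exactly the two stubs). BC3 probes (stub → crux,
stub → `Crystallization` fail for both): `Cruxes/HcpPeriodicMinimiser/BC2-REDIRECT.md`. Disproof used:
none on file (no `Disproof.lean` for 5832/3061); negatives index: no refuted statement concerns
layering of periodic competitors.
-/

namespace Summit.AtomisticToContinuum.Crystallization.Cruxes.TriangularLayering.Birth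

/-- **Stub 1 — lattice layering.** Every hard-core periodic configuration of `ℝ³` with two linearly
independent periods of length `≤ 6/5` is matched, at no higher Lennard-Jones energy per particle, by
a LATTICE-LAYER STACK: hard core `1/2`, two linearly independent horizontal periods `u, v` of length
`≤ 6/5`, one `ℤu+ℤv`-orbit per occupied height, occupied heights `≥ 7/10` apart, next layer within
`[7/10, 1]`. Open (XL: flattening/thinning of 2-orbit layers); weaker than the crux (shape free). -/
theorem stub_latticeLayering : ∀ Q : Literature.MathematicalPhysics.StatisticalMechanics.PeriodicConfiguration 3, (∀ x ∈ Q.points, ∀ y ∈ Q.points, x ≠ y → (1 / 2 : ℝ) ≤ dist x y) → (∃ u ∈ Q.lattice, ∃ v ∈ Q.lattice, LinearIndependent ℝ ![u, v] ∧ ‖u‖ ≤ 6 / 5 ∧ ‖v‖ ≤ 6 / 5) → ∃ Q' : Literature.MathematicalPhysics.StatisticalMechanics.PeriodicConfiguration 3, Q'.energyPerParticle Literature.MathematicalPhysics.StatisticalMechanics.lennardJones ≤ Q.energyPerParticle Literature.MathematicalPhysics.StatisticalMechanics.lennardJones ∧ (∀ x ∈ Q'.points, ∀ y ∈ Q'.points,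 x ≠ y → (1 / 2 : ℝ) ≤ dist x y) ∧ (∃ u ∈ Q'.lattice, ∃ v ∈ Q'.lattice, u 2 = 0 ∧ v 2 = 0 ∧ LinearIndependent ℝ ![u, v] ∧ ‖u‖ ≤ 6 / 5 ∧ ‖v‖ ≤ 6 / 5 ∧ (∀ x ∈ Q'.points, ∀ y ∈ Q'.points, x 2 = y 2 → x - y ∈ Submodule.span ℤ ({u, v} : Set (EuclideanSpace ℝ (Fin 3))))) ∧ (∀ x ∈ Q'.points, ∀ y ∈ Q'.points, x 2 ≠ y 2 → (7 / 10 : ℝ) ≤ |x 2 - y 2|) ∧ (∀ x ∈ Q'.points, ∃ y ∈ Q'.points, (7 / 10 : ℝ) ≤ y 2 - x 2 ∧ y 2 - x 2 ≤ 1) := by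
  sorry

/-- **Stub 2 — the triangular shape wins among lattice-layer stacks.** Every lattice-layer stack is
matched, at no higher energy per particle, by a monolayer triangular stack `A₂(a)`, `a ∈ [47/50, 1]`
(lateral offsets free, gaps in `[7/10, 1]`). Size L (Montgomery1988 / Betermin2023 lattice comparison
+ LJ-signed inter-layer corrections + certified scale window). -/
theorem stub_triangularShape : ∀ Q : Literature.MathematicalPhysics.StatisticalMechanics.PeriodicConfiguration 3, (∀ x ∈ Q.points, ∀ y ∈ Q.points, x ≠ y → (1 / 2 : ℝ) ≤ dist x y) ∧ (∃ u ∈ Q.lattice, ∃ v ∈ Q.lattice, u 2 = 0 ∧ v 2 = 0 ∧ LinearIndependent ℝ ![u, v] ∧ ‖u‖ ≤ 6 / 5 ∧ ‖v‖ ≤ 6 / 5 ∧ (∀ x ∈ Q.points, ∀ y ∈ Q.points, x 2 = y 2 → x - y ∈ Submodule.span ℤ ({u, v} : Set (EuclideanSpace ℝ (Fin 3))))) ∧ (∀ x ∈ Q.points, ∀ y ∈ Q.points, x 2 ≠ y 2 → (7 / 10 : ℝ) ≤ |x 2 - y 2|) ∧ (∀ x ∈ Q.points, ∃ y ∈ Q.points,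 (7 / 10 : ℝ) ≤ y 2 - x 2 ∧ y 2 - x 2 ≤ 1) → ∃ Q' : Literature.MathematicalPhysics.StatisticalMechanics.PeriodicConfiguration 3, Q'.energyPerParticle Literature.MathematicalPhysics.StatisticalMechanics.lennardJones ≤ Q.energyPerParticle Literature.MathematicalPhysics.StatisticalMechanics.lennardJones ∧ ∃ a : ℝ, 47 / 50 ≤ a ∧ a ≤ 1 ∧ Literature.MathematicalPhysics.StatisticalMechanics.triangularVec₁ a ∈ Q'.lattice ∧ Literature.MathematicalPhysics.StatisticalMechanics.triangularVec₂ a ∈ Q'.lattice ∧ (∀ x ∈ Q'.points, ∀ y ∈ Q'.points, x 2 = y 2 → x - y ∈ Submodule.span ℤ ({Literature.MathematicalPhysics.StatisticalMechanics.triangularVec₁ a, Literature.MathematicalPhysics.StatisticalMechanics.triangularVec₂ a} : Set (EuclideanSpace ℝ (Fin 3)))) ∧ (∀ x ∈ Q'.points, ∀ y ∈ Q'.points, x 2 ≠ y 2 → (7 / 10 : ℝ) ≤ |x 2 - y 2|) ∧ (∀ x ∈ Q'.points, ∃ y ∈ Q'.points, (7 / 10 : ℝ) ≤ y 2 - x 2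 ∧ y 2 - x 2 ≤ 1) := by
  sorry

/-- **Assembly**: stub 1 → stub 2 → the crux (layer, reshape, chain the energies). Concludes
`SymmetryRankLadder.TriangularLayering` by name; no `sorry`. -/
theorem TriangularLayering_of : (∀ Q : Literature.MathematicalPhysics.StatisticalMechanics.PeriodicConfiguration 3, (∀ x ∈ Q.points, ∀ y ∈ Q.points, x ≠ y → (1 / 2 : ℝ) ≤ dist x y) → (∃ u ∈ Q.lattice, ∃ v ∈ Q.lattice, LinearIndependent ℝ ![u, v] ∧ ‖u‖ ≤ 6 / 5 ∧ ‖v‖ ≤ 6 / 5) → ∃ Q' : Literature.MathematicalPhysics.StatisticalMechanics.PeriodicConfiguration 3, Q'.energyPerParticle Literature.MathematicalPhysics.StatisticalMechanics.lennardJones ≤ Q.energyPerParticle Literature.MathematicalPhysics.StatisticalMechanics.lennardJones ∧ (∀ x ∈ Q'.points, ∀ y ∈ Q'.points, x ≠ y → (1 / 2 : ℝ) ≤ dist x y) ∧ (∃ u ∈ Q'.lattice, ∃ v ∈ Q'.lattice, u 2 = 0 ∧ v 2 = 0 ∧ LinearIndependent ℝ ![u, v] ∧ ‖u‖ ≤ 6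 / 5 ∧ ‖v‖ ≤ 6 / 5 ∧ (∀ x ∈ Q'.points, ∀ y ∈ Q'.points, x 2 = y 2 → x - y ∈ Submodule.span ℤ ({u, v} : Set (EuclideanSpace ℝ (Fin 3))))) ∧ (∀ x ∈ Q'.points, ∀ y ∈ Q'.points, x 2 ≠ y 2 → (7 / 10 : ℝ) ≤ |x 2 - y 2|) ∧ (∀ x ∈ Q'.points, ∃ y ∈ Q'.points, (7 / 10 : ℝ) ≤ y 2 - x 2 ∧ y 2 - x 2 ≤ 1)) → (∀ Q : Literature.MathematicalPhysics.StatisticalMechanics.PeriodicConfiguration 3, (∀ x ∈ Q.points, ∀ y ∈ Q.points, x ≠ y → (1 / 2 : ℝ) ≤ dist x y) ∧ (∃ u ∈ Q.lattice, ∃ v ∈ Q.lattice, u 2 = 0 ∧ v 2 = 0 ∧ LinearIndependent ℝ ![u, v] ∧ ‖u‖ ≤ 6 / 5 ∧ ‖v‖ ≤ 6 / 5 ∧ (∀ x ∈ Q.points, ∀ y ∈ Q.points, x 2 = y 2 → x - y ∈ Submodule.span ℤ ({u, v} : Set (EuclideanSpace ℝ (Fin 3))))) ∧ (∀ x ∈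 Q.points, ∀ y ∈ Q.points, x 2 ≠ y 2 → (7 / 10 : ℝ) ≤ |x 2 - y 2|) ∧ (∀ x ∈ Q.points, ∃ y ∈ Q.points, (7 / 10 : ℝ) ≤ y 2 - x 2 ∧ y 2 - x 2 ≤ 1) → ∃ Q' : Literature.MathematicalPhysics.StatisticalMechanics.PeriodicConfiguration 3, Q'.energyPerParticle Literature.MathematicalPhysics.StatisticalMechanics.lennardJones ≤ Q.energyPerParticle Literature.MathematicalPhysics.StatisticalMechanics.lennardJones ∧ ∃ a : ℝ, 47 / 50 ≤ a ∧ a ≤ 1 ∧ Literature.MathematicalPhysics.StatisticalMechanics.triangularVec₁ a ∈ Q'.lattice ∧ Literature.MathematicalPhysics.StatisticalMechanics.triangularVec₂ a ∈ Q'.lattice ∧ (∀ x ∈ Q'.points, ∀ y ∈ Q'.points, x 2 = y 2 → x - y ∈ Submodule.span ℤ ({Literature.MathematicalPhysics.StatisticalMechanics.triangularVec₁ a, Literature.MathematicalPhysics.StatisticalMechanics.triangularVec₂ a} : Set (EuclideanSpace ℝ (Fin 3)))) ∧ (∀ x ∈ Q'.points, ∀ y ∈ Q'.points, x 2 ≠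 y 2 → (7 / 10 : ℝ) ≤ |x 2 - y 2|) ∧ (∀ x ∈ Q'.points, ∃ y ∈ Q'.points, (7 / 10 : ℝ) ≤ y 2 - x 2 ∧ y 2 - x 2 ≤ 1)) → Summit.AtomisticToContinuum.Crystallization.Theses.SymmetryRankLadder.TriangularLayering := by
  intro h₁ h₂ Q hc hp
  obtain ⟨Q₁, hQ₁, hL⟩ := h₁ Q hc hp
  obtain ⟨Q₂, hQ₂, a, ha₁, ha₂, hm⟩ := h₂ Q₁ hL
  exact ⟨Q₂, hQ₂.trans hQ₁, a, ha₁, ha₂, hm⟩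

/-- The crux modulo exactly the two stubs. -/
theorem TriangularLayering_skeleton : Summit.AtomisticToContinuum.Crystallization.Theses.SymmetryRankLadder.TriangularLayering :=
  TriangularLayering_of stub_latticeLayering stub_triangularShape

end Summit.AtomisticToContinuum.Crystallization.Cruxes.TriangularLayering.Birth
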